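import Summits.QuantumFields.BalabanUV.T4Continuum.Spine.NE3.FrameNormalisationOneLevel
import Summits.QuantumFields.BalabanUV.T4Continuum.Support.AveragingDeficitTransport
import Literature.MathematicalPhysics.QuantumFieldTheory.Balaban1983to89.B7Eq162General
import HarnessLib

/-!
# T⁴ programme, node NE3 — census R50, SIZE LETTER of the zeroth-order frame normalisation: a hierarchically block-covariantly-constant gauge is EVERYWHERE as close to `1`
# as its top corner data (unitary conjugation is an isometry), hence `‖v − 1‖ ≤ 64·d·L^k·b` for the frame gauge of `FrameNormalisation` in the [B7]-Prop.-4 regime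
# ([Balaban1985Averaging] (163)) — the located (0)-size of the face jumps (`FrameNormalisationSize`)

Cell `pub-balaban-gaps` (track G2, seat ne3, generation 11), row NE3; census `HOME/ne/NE3.md` §4 R50, §17.  `FrameNormalisation.exists_frameNormalised` solves the frame condition
(hence (1.37)) EXACTLY by a hierarchically block-covariantly-constant gauge `v` with top corner data `c(z) = v_k(U₀′)(z)` (pinned pre-gauge).  This module quantifies that gauge:

* §1 `norm_Rc_sub_one` — `‖R(h)X − 1‖ = ‖X − 1‖` for unitary `h` (`AveragingDeficitTransport.norm_Ad_of_unitary`).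
* §2 **`norm_sub_one_le_of_hier`** — if the averaged backgrounds `Ū₀ⁱ = avgIter L W i`, `i < k`, are unitary and `v` is hierarchically block-covariantly constant with
  `‖v(L^kz) − 1‖ ≤ S` for all `z`, then `‖v(x) − 1‖ ≤ S` at EVERY site `x` (downward induction: the level-`i` corner values are unitary conjugates of the level-`(i+1)` ones).
* §3 **`norm_frameGauge_sub_one_le`** — in the regime of [Balaban1985Averaging] Prop. 4 at a general `U(n)`-valued background (`B7Eq123General.prop4_general`'s hypotheses:
  `pdev W < α₀(L^k)⁻²`, `C0·α₀ ≤ 1∕3`, `4α₀ ≤ c2′`, the two smallness lines, `2048·d·L^k·b ≤ 1`) and for a perturbation `U₀′ = e^{B}` with `sup‖B‖ ≤ b`: the zeroth-order frame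
  gauge of the PINNED pre-gauge (top data `v_k(U₀′)`) satisfies **`‖v(x) − 1‖ ≤ 64·d·L^k·b`** everywhere — by §2 with `S` = the (163) bound `B7Eq162General.eq163_general` and the
  unitarity of the averaged backgrounds `B7Prop2Explicit.avgIter_mem`.  With [B8] (1.36) `b = s₁ξ`, `L^k·b = s₁`: the bound is `64·d·s₁` — k-FREE but (0)-SIZE, which is the located
  reason (census R50∕R53) why this exact realisation of (1.37) is only the zeroth-order one: across block faces the normalised perturbation `U₀′^{v}` can move by `2‖v − 1‖`,
  not by a (−1)-size amount.

HONEST FRAMING (page 1).  Elementary bookkeeping over landed theorems BY NAME (0 def, 0 sorry); nothing of Bałaban's is asserted (the (163) bound is the b07 lineage's kernel theorem at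
a general background); the smooth∕joint realisation of (1.37) with (1.38) is NOT touched; `PairLandauGaugeB8Avg`, the covariant root and **NE3 are NOT proved**; spine PROVED 0∕9; finite T⁴
rung (B)+1 — NOT continuum YM on ℝ⁴, NOT infinite volume, NOT mass gap, NOT `BetaPertH`, NOT Clay.  HONEST DEPENDENCY: continuum YM on T⁴ ⇐ BetaPertH ∧ nine spine estimates (0/9
proved); BetaPertH ⇐ (D1) ∧ (D4) ∧ CAP+tail; G-an2-4 gates asym, D1 and NE2/3/4.  PLACEMENT: `Summits/QuantumFields/BalabanUV/T4Continuum/Spine/NE3/`; imports `FrameNormalisationOneLevel`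
(for the block decomposition), `Support/AveragingDeficitTransport` and `B7Eq162General`; the hypotheses `htop`∕`hhier` are the shape of `FrameNormalisation.exists_frameNormalised`.

References: [Balaban1985Averaging] T. Bałaban, *Averaging operations for lattice gauge theories*, CMP 98 (1985) 17–51, (163) p. 42, Prop. 2 (54) p. 26, Prop. 4 (123) p. 37.
-/

set_option autoImplicit false

open scoped BigOperators Matrix Matrix.Norms.L2Operator
open NormedSpace

namespace Summit.QuantumFields.BalabanUV.T4Continuum.NE3.FrameNormalisationSize

open Literature.MathematicalPhysics.QuantumFieldTheory.Balaban1983to89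
open B7Prop1Explicit B7Prop2Explicit B7Prop3Flat MatrixLog
open B7AvgGaugeCovariance (uLev uLev_apply uLev_smul)
open B7Eq92Concrete (Rc Rc_apply Rc_inv_apply vcov)
open B7Eq162General (eq163_general)
open T4AveragingDeficitWall (Ad)
open AveragingDeficitTransport (norm_Ad_of_unitary)
open NE3.FrameNormalisationOneLevel (site_eq_corner_add_boxVec)

noncomputable section

variable {d : ℕ} {n : Type*} [Fintype n] [DecidableEq n]

/-! ## §1 Unitary conjugation does not change the distance to `1` -/

/-- `‖R(h)X − 1‖ = ‖X − 1‖` for a unitary unit `h` (`R(h)X − 1 = Ad_h(X − 1)`, and `Ad_h` is an isometry of the operator norm). [folklore] -/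
theorem norm_Rc_sub_one {h : (Matrix n n ℂ)ˣ} (hh : h ∈ unitaryUnits (Matrix n n ℂ)) (X : (Matrix n n ℂ)ˣ) :
    ‖((Rc h X : (Matrix n n ℂ)ˣ) : Matrix n n ℂ) - 1‖ = ‖(X : Matrix n n ℂ) - 1‖ := by
  have hAd : ((Rc h X : (Matrix n n ℂ)ˣ) : Matrix n n ℂ) - 1 = Ad h ((X : Matrix n n ℂ) - 1) := by
    unfold Ad
    rw [Rc_apply, Units.val_mul, Units.val_mul, mul_sub, sub_mul, mul_one, Units.mul_inv]
  rw [hAd, norm_Ad_of_unitary hh]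

/-! ## §2 A hierarchically block-covariantly-constant gauge is everywhere as close to `1` as its top corner data -/

/-- **`‖v(x) − 1‖ ≤ S` EVERYWHERE** if the averaged backgrounds `Ū₀ⁱ`, `i < k`, are unitary, `v` is hierarchically block-covariantly constant, and its top corner values satisfy
`‖v(L^kz) − 1‖ ≤ S` (`L ≥ 1`).  Downward induction on the level: `v_i(Ly + r) = R(Ū₀ⁱ(Γ))⁻¹ v_{i+1}(y)` is a unitary conjugate. [folklore] -/
theorem norm_sub_one_le_of_hier {L : ℕ} (hL : 1 ≤ L) (k : ℕ) {W : Site d → Fin d → (Matrix n n ℂ)ˣ} {v : Site d → (Matrix n n ℂ)ˣ} {S : ℝ}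
    (hWu : ∀ i < k, ∀ (x : Site d) (κ : Fin d), avgIter L W i x κ ∈ unitaryUnits (Matrix n n ℂ))
    (hhier : ∀ i < k, ∀ (y : Site d) (r : Fin d → Fin L),
      Rc (hol (avgIter L W i) ((L : ℤ) • y) (treeWord (boxVec L r))) (uLev L v i ((L : ℤ) • y + boxVec L r)) = uLev L v i ((L : ℤ) • y))
    (htop : ∀ z : Site d, ‖(v (((L : ℤ) ^ k) • z) : Matrix n n ℂ) - 1‖ ≤ S) :
    ∀ x : Site d, ‖(v x : Matrix n n ℂ) - 1‖ ≤ S := by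
  -- `P m`: the values at the level-`(k − m)` corners are within `S` of `1`, for `m ≤ k`
  have key : ∀ m : ℕ, m ≤ k → ∀ y : Site d, ‖(v (((L : ℤ) ^ (k - m)) • y) : Matrix n n ℂ) - 1‖ ≤ S := by
    intro m
    induction m with
    | zero => intro _ y; rw [Nat.sub_zero]; exact htop y
    | succ m ih =>
      intro hm y
      have hi : k - (m + 1) < k := by omega
      have hkm : k - m = k - (m + 1) + 1 := by omega
      obtain ⟨y₁, r, hy⟩ := site_eq_corner_add_boxVec (d := d) hL y
      -- `v(L^i • y) = v_i (L y₁ + r) = R(hol)⁻¹ (v_i (L y₁))`, `v_i (L y₁) = v (L^{i+1} y₁)`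
      have hc := hhier (k - (m + 1)) hi y₁ r
      have h1 : v (((L : ℤ) ^ (k - (m + 1))) • y) = uLev L v (k - (m + 1)) ((L : ℤ) • y₁ + boxVec L r) := by
        rw [uLev_apply, hy]
      have h2 : uLev L v (k - (m + 1)) ((L : ℤ) • y₁) = v (((L : ℤ) ^ (k - m)) • y₁) := by
        rw [uLev_smul, uLev_apply, ← hkm]
      have h3 : uLev L v (k - (m + 1)) ((L : ℤ) • y₁ + boxVec L r)
          = Rc (hol (avgIter L W (k - (m + 1))) ((L : ℤ) • y₁) (treeWord (boxVec L r)))⁻¹ (v (((L : ℤ) ^ (k - m)) • y₁)) := by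
        rw [← h2, ← hc, (Rc_inv_apply _ _).1]
      rw [h1, h3, norm_Rc_sub_one]
      · exact ih (by omega) y₁
      · exact Subgroup.inv_mem _ (hol_mem_of (hWu _ hi) _ _)
  intro x
  have h := key k le_rfl x
  rwa [Nat.sub_self, pow_zero, one_smul] at h

/-! ## §3 The size of the zeroth-order frame gauge in the [B7]-Prop.-4 regime -/

/-- **THE ZEROTH-ORDER FRAME GAUGE IS WITHIN `64·d·L^k·b` OF `1` EVERYWHERE** (pinned pre-gauge: top data `v(L^kz) = v_k(U₀′)(z)`, `U₀′ = e^{B}`, `sup‖B‖ ≤ b`), in the regime of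
[Balaban1985Averaging] Prop. 4 at the `U(n)`-valued background `W` (`2 ≤ L`): the averaged backgrounds are unitary (`B7Prop2Explicit.avgIter_mem`), the accumulated frame obeys (163)
(`B7Eq162General.eq163_general`: `‖v_k(U₀′)(z) − 1‖ ≤ e^{32dL^kb} − 1 ≤ 64·d·L^k·b`), and §2 transports the bound to every site.  With (1.36)'s `b = s₁ξ` this is `64·d·s₁`:
k-free, (0)-size — the located face-jump scale of the exact realisation of (1.37). [folklore] -/
theorem norm_frameGauge_sub_one_le [Nonempty n] {L : ℕ} (hL : 2 ≤ L) (k : ℕ) {W : Site d → Fin d → (Matrix n n ℂ)ˣ}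
    (hWu : ∀ (x : Site d) (κ : Fin d), W x κ ∈ unitaryUnits (Matrix n n ℂ)) {α₀ b : ℝ} (hα : 0 < α₀) (hα3 : C0 d * α₀ ≤ 1 / 3) (hα4 : 4 * α₀ ≤ c2' d L)
    (h52 : pdev W < α₀ * (((L : ℝ) ^ k)⁻¹) ^ 2) (hb : 0 ≤ b) {B : Site d → Fin d → Matrix n n ℂ} (hB : ∀ (x : Site d) (κ : Fin d), ‖B x κ‖ ≤ b)
    (hsmall : Real.exp (4 * (800 * ((d : ℝ) + 1) ^ 2 * ((d : ℝ) + 4)) * α₀) * (1 + 8 * (131072 * ((d : ℝ) + 1) ^ 2) * ((L : ℝ) ^ k * b)) ≤ 2)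
    (hc₃ : 2 * ((L : ℝ) ^ k * b) ≤ c3 d L) (hsm : 2048 * (d : ℝ) * ((L : ℝ) ^ k * b) ≤ 1)
    {v : Site d → (Matrix n n ℂ)ˣ} (htop : ∀ z : Site d, v (((L : ℤ) ^ k) • z) = vcov L W (expCfg B) k z)
    (hhier : ∀ i < k, ∀ (y : Site d) (r : Fin d → Fin L),
      Rc (hol (avgIter L W i) ((L : ℤ) • y) (treeWord (boxVec L r))) (uLev L v i ((L : ℤ) • y + boxVec L r)) = uLev L v i ((L : ℤ) • y)) :
    ∀ x : Site d, ‖(v x : Matrix n n ℂ) - 1‖ ≤ 64 * (d : ℝ) * ((L : ℝ) ^ k * b) := by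
  letI : CStarAlgebra (Matrix n n ℂ) := {}
  have hG := avgClosed_unitaryUnits d (𝔸 := Matrix n n ℂ) L
  have hα2 : 2 * α₀ ≤ c2' d L := by linarith
  have hunit := avgIter_mem L hL hG k W hWu hα hα3 hα2 h52
  have h163 := fun z => eq163_general (G := unitaryUnits (Matrix n n ℂ)) hL hG hWu hα hα3 hα4 h52 hb hB hsmall hc₃ hsm (le_refl k) z
  refine norm_sub_one_le_of_hier (by omega) k (fun i hi x κ => hunit i hi.le x κ) hhier fun z => ?_
  rw [htop z]
  exact (h163 z).1.1.trans (h163 z).2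

end

end Summit.QuantumFields.BalabanUV.T4Continuum.NE3.FrameNormalisationSize
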